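import Summits.Ventures.CertifiedManyBodySolver.Downfold.EmeryOrbitalWeightAxisBox
import Summits.Ventures.CertifiedManyBodySolver.Downfold.EmeryOrbitalWeightNodeBox
import Summits.Ventures.CertifiedManyBodySolver.Downfold.EmeryScaleBoxBi2201NH1144Pts
import Summits.Ventures.CertifiedManyBodySolver.Downfold.EmeryScaleBoxBi2201NH1176Pts
import Summits.Ventures.CertifiedManyBodySolver.Downfold.EmeryScaleBoxCCOCNH110Pts
import Summits.Ventures.CertifiedManyBodySolver.Downfold.EmeryScaleBoxHg1201P10NH1125Pts
import Summits.Ventures.CertifiedManyBodySolver.Downfold.EmeryScaleBoxHg1201P10NH116Pts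
import Summits.Ventures.CertifiedManyBodySolver.Downfold.EmeryScaleBoxTl2201NH125Pts
import Summits.Ventures.CertifiedManyBodySolver.Downfold.EmeryScaleBoxTl2201NH130Pts
import Summits.Ventures.CertifiedManyBodySolver.Downfold.EmeryScaleBoxYBCO7NH116Pts
import HarnessLib

/-!
# CENSUS (part A of 3) — THE UNIVERSAL [NODE FLOOR, AXIS CEILING] BRACKET OF THE FERMI-SURFACE Cu-d WEIGHT OVER THE TYPED 3BE BOXES WITH LANDED FERMI-ENERGY BRACKETS
# (INFL-3to1-B §B.89 (c) floor + §B.90 (e) ceiling; kernels `EmeryOrbitalWeightNodeBox`, `EmeryOrbitalWeightAxisBox`; router/EMERY-FS-WEIGHT-BRACKETS.tsv)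

Venture CertifiedManyBodySolver, cell `pub/hubbard-downfold` (stage S1), seat hubbard-downfold-mod-4 (technique B, g38); namespace
`Summit.Ventures.CertifiedManyBodySolver.Downfold.Emery`. Everything PROVED (0 sorry; no new `decide`: the FL/TP brackets `scalePt_<Key><X>_FL_br` / `_TP_br` of the g36 scale census
`EmeryScaleBox<Key><X>Pts` are re-read). WHAT THIS IS NOT: statements about the materials — the typed boxes ((K) source boxes, router companions) are SCREENING-GRADE; `U = 0` one-body
kinematics of the σ model; the brackets feed the band-level `U` annex (R-B17 context) — no `U_B` number is stated here (the (K) source boxes carry no interaction entries).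

For every member θ of the box at filling ν and EVERY zone point k of its Fermi surface: `dWeightNodeCF(Δ₁, a₁, b₂ − c₁; E_h) ≤ w_node(θ) ≤ w_d(k) ≤ w_axis(θ; ε_F) ≤ dWeightAxisCF(Δ₂, a₁, c₂; E_l)`
(`dWeightNode_fermiEnergyOf_mem_Icc_of_mem_box_num` + `dWeight_mem_Icc_node_axis` + `dWeight_le_of_mem_box_axis'`). The SHARP antinodal window (`EmeryBoxes<Tag>FaceWeight<X>`) needs
the antinodal charge-transfer regime `4(t_pp + t_pp′) ≤ Δ + ε_F`, which the (K) cuprate source boxes MISS by 0.01–0.4 eV at their low-Δ / high-t_pp corner (float, value-free: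
`facebox-g38/inst/member_regime.py`; E/4g ∈ [0.89, 1.00] there; CCOC 1.08 and NdNiO₂ 1.57 pass) — hence this universal bracket is the census object; the antinodal windows of the
passing boxes are separate instance files (`EmeryBoxes<Tag>FaceWeight<X>`).

| box | material | filling | E_l | E_h | **[node floor, axis ceiling]** |
|---|---|---|---|---|---|
| `Hg1201P10` | HgBa₂CuO₄ @10 GPa (box #19 @10) | nH1125 (ν = 7/16) | 1.7481 | 2.5793 | **[0.4992, 0.7308]** |
| `Hg1201P10` | HgBa₂CuO₄ @10 GPa (box #19 @10) | nH116 (ν = 21/50) | 1.716 | 2.5268 | **[0.5024, 0.7325]** |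
| `YBCO7` | YBa₂Cu₃O₇ plane Cu(2) ((K) #66-type source box) | nH116 (ν = 21/50) | 1.34 | 1.9572 | **[0.5724, 0.7635]** |
| `CCOC` | Ca₂₋ₓNaₓCuO₂Cl₂ x = 0.10 ((K) #3 source box) | nH110 (ν = 9/20) | 1.3103 | 1.9286 | **[0.5966, 0.777]** |
| `Bi2201` | Bi₂Sr₂CuO₆₊δ (M61; Morée PP source box) | nH1144 (ν = 107/250) | 1.4728 | 2.131 | **[0.5644, 0.7561]** |
| `Bi2201` | Bi₂Sr₂CuO₆₊δ (M61; Morée PP source box) | nH1176 (ν = 103/250) | 1.4456 | 2.0919 | **[0.5677, 0.7576]** |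
| `Tl2201` | Tl₂Ba₂CuO₆ ((K) #12 source POINT) | nH125 (ν = 3/8) | 1.6114 | 1.6214 | **[0.6289, 0.7129]** |
| `Tl2201` | Tl₂Ba₂CuO₆ ((K) #12 source POINT) | nH130 (ν = 7/20) | 1.5773 | 1.5873 | **[0.6325, 0.7145]** |

Sources: three-band model [HybertsenSchluterChristensen1989, Eq. (1)]; [AndersenEtAl1995, §6]; [folklore] algebra; box rows as cited in each typed object's file.
-/

noncomputable section

namespace Summit.Ventures.CertifiedManyBodySolver.Downfold.Emery

open Real Set

/-- **`emeryBoxHg1201P10 (EmeryBoxesPressure)` (HgBa₂CuO₄ @10 GPa (box #19 @10)), n_H = 1.125 (ν = 7/16): EVERY Fermi-surface Bloch state of EVERY member has Cu-d weight in `[0.4992, 0.7308]`** — node floor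
`dWeightNodeCF(Δ₁, a₁, b₂ − c₁; E_h)` (two-corner rule, §B.89 (c)) and axis ceiling `dWeightAxisCF(Δ₂, a₁, c₂; E_l)` (§B.90 (e)); brackets `scalePt_Hg1201P10NH1125_FL_br` / `scalePt_Hg1201P10NH1125_TP_br`; any Fermi-surface topology. [folklore] -/
theorem hg1201P10Box_dWeightFS_mem_nH1125 {Δ a b c x y : ℝ} (hΔ : Δ ∈ Icc ((23 : ℝ) / 20) ((5 : ℝ) / 2)) (ha : a ∈ Icc ((139 : ℝ) / 100) ((77 : ℝ) / 50)) (hb : b ∈ Icc ((17 : ℝ) / 25) ((79 : ℝ) / 100))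
    (hc : c ∈ Icc ((289 : ℝ) / 2500) ((289 : ℝ) / 2500)) (hx : x ∈ Icc (0 : ℝ) 1) (hy : y ∈ Icc (0 : ℝ) 1)
    (hP : charCubic Δ a b c x y (fermiEnergyOf Δ a b c ((7 : ℝ) / 16)) = 0) :
    dWeight Δ a b c x y (fermiEnergyOf Δ a b c ((7 : ℝ) / 16)) ∈ Icc ((312 : ℝ) / 625) ((1827 : ℝ) / 2500) := by
  have hF := (fermiEnergyOf_of_pointBracketCheck scalePt_Hg1201P10NH1125_FL_br (by norm_num) (by norm_num) (by norm_num) (ν := (7/16 : ℝ))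
    (by push_cast; exact ⟨le_rfl, le_rfl⟩)).2
  have hT := (fermiEnergyOf_of_pointBracketCheck scalePt_Hg1201P10NH1125_TP_br (by norm_num) (by norm_num) (by norm_num) (ν := (7/16 : ℝ))
    (by push_cast; exact ⟨le_rfl, le_rfl⟩)).2
  push_cast at hF hT
  have hbox := fermiEnergyOf_mem_Icc_of_mem_box' (Δ₁ := ((23 : ℝ) / 20)) (Δ₂ := ((5 : ℝ) / 2)) (a₁ := ((139 : ℝ) / 100)) (a₂ := ((77 : ℝ) / 50)) (b₁ := ((17 : ℝ) / 25)) (b₂ := ((79 : ℝ) / 100)) (c₁ := ((289 : ℝ) / 2500)) (c₂ := ((289 : ℝ) / 2500))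
    (ν := ((7 : ℝ) / 16)) (by norm_num) (by norm_num) (by norm_num) (by norm_num) hΔ ha hb hc (by norm_num) (by norm_num)
  have hε0 : 0 < fermiEnergyOf Δ a b c ((7 : ℝ) / 16) := lt_of_lt_of_le (by norm_num) (hF.1.trans hbox.1)
  have hmE : c * fermiEnergyOf Δ a b c ((7 : ℝ) / 16) < a ^ 2 := by
    have h1 : c * fermiEnergyOf Δ a b c ((7 : ℝ) / 16) ≤ ((289 : ℝ) / 2500) * ((25793 : ℝ) / 10000) := mul_le_mul hc.2 (hbox.2.trans hT.2) hε0.le (by norm_num)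
    have h2 : (((139 : ℝ) / 100) : ℝ) ^ 2 ≤ a ^ 2 := by nlinarith [ha.1]
    nlinarith
  have hnode := dWeightNode_fermiEnergyOf_mem_Icc_of_mem_box_num (El := ((17481 : ℝ) / 10000)) (Eh := ((25793 : ℝ) / 10000)) (lo := ((312 : ℝ) / 625)) (hi := 1)
    (by norm_num) (by norm_num) (by norm_num) (by norm_num) hΔ ha hb hc (by norm_num) (by norm_num) (by norm_num) hF.1 hT.2 (by norm_num [dWeightNodeCF])
    (dWeightNodeCF_le_one (by norm_num) (by norm_num) (by norm_num) (by norm_num))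
  have hlink := (dWeight_mem_Icc_node_axis (le_of_lt (lt_of_lt_of_le (by norm_num) hΔ.1)) (le_trans (by norm_num) hc.1) ((hc.2.trans (by norm_num)).trans hb.1)
    (lt_of_lt_of_le (by norm_num) hb.1) (ne_of_gt (lt_of_lt_of_le (by norm_num) ha.1)) hε0 hmE hx hy hP).2.1
  exact ⟨hnode.1.trans hlink, dWeight_le_of_mem_box_axis' (El := ((17481 : ℝ) / 10000)) (Eh := ((25793 : ℝ) / 10000)) (by norm_num) (by norm_num) (by norm_num) (by norm_num) (by norm_num) hΔ ha hb hc
    (by norm_num) (by norm_num) (by norm_num) hF.1 hT.2 (by norm_num) (by norm_num) (by norm_num) (by norm_num [dWeightAxisCF]) hx hy hP⟩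

/-- **`emeryBoxHg1201P10 (EmeryBoxesPressure)` (HgBa₂CuO₄ @10 GPa (box #19 @10)), n_H = 1.16 (ν = 21/50): EVERY Fermi-surface Bloch state of EVERY member has Cu-d weight in `[0.5024, 0.7325]`** — node floor
`dWeightNodeCF(Δ₁, a₁, b₂ − c₁; E_h)` (two-corner rule, §B.89 (c)) and axis ceiling `dWeightAxisCF(Δ₂, a₁, c₂; E_l)` (§B.90 (e)); brackets `scalePt_Hg1201P10NH116_FL_br` / `scalePt_Hg1201P10NH116_TP_br`; any Fermi-surface topology. [folklore] -/
theorem hg1201P10Box_dWeightFS_mem_nH116 {Δ a b c x y : ℝ} (hΔ : Δ ∈ Icc ((23 : ℝ) / 20) ((5 : ℝ) / 2)) (ha : a ∈ Icc ((139 : ℝ) / 100) ((77 : ℝ) / 50)) (hb : b ∈ Icc ((17 : ℝ) / 25) ((79 : ℝ) / 100))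
    (hc : c ∈ Icc ((289 : ℝ) / 2500) ((289 : ℝ) / 2500)) (hx : x ∈ Icc (0 : ℝ) 1) (hy : y ∈ Icc (0 : ℝ) 1)
    (hP : charCubic Δ a b c x y (fermiEnergyOf Δ a b c ((21 : ℝ) / 50)) = 0) :
    dWeight Δ a b c x y (fermiEnergyOf Δ a b c ((21 : ℝ) / 50)) ∈ Icc ((314 : ℝ) / 625) ((293 : ℝ) / 400) := by
  have hF := (fermiEnergyOf_of_pointBracketCheck scalePt_Hg1201P10NH116_FL_br (by norm_num) (by norm_num) (by norm_num) (ν := (21/50 : ℝ))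
    (by push_cast; exact ⟨le_rfl, le_rfl⟩)).2
  have hT := (fermiEnergyOf_of_pointBracketCheck scalePt_Hg1201P10NH116_TP_br (by norm_num) (by norm_num) (by norm_num) (ν := (21/50 : ℝ))
    (by push_cast; exact ⟨le_rfl, le_rfl⟩)).2
  push_cast at hF hT
  have hbox := fermiEnergyOf_mem_Icc_of_mem_box' (Δ₁ := ((23 : ℝ) / 20)) (Δ₂ := ((5 : ℝ) / 2)) (a₁ := ((139 : ℝ) / 100)) (a₂ := ((77 : ℝ) / 50)) (b₁ := ((17 : ℝ) / 25)) (b₂ := ((79 : ℝ) / 100)) (c₁ := ((289 : ℝ) / 2500)) (c₂ := ((289 : ℝ) / 2500))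
    (ν := ((21 : ℝ) / 50)) (by norm_num) (by norm_num) (by norm_num) (by norm_num) hΔ ha hb hc (by norm_num) (by norm_num)
  have hε0 : 0 < fermiEnergyOf Δ a b c ((21 : ℝ) / 50) := lt_of_lt_of_le (by norm_num) (hF.1.trans hbox.1)
  have hmE : c * fermiEnergyOf Δ a b c ((21 : ℝ) / 50) < a ^ 2 := by
    have h1 : c * fermiEnergyOf Δ a b c ((21 : ℝ) / 50) ≤ ((289 : ℝ) / 2500) * ((6317 : ℝ) / 2500) := mul_le_mul hc.2 (hbox.2.trans hT.2) hε0.le (by norm_num)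
    have h2 : (((139 : ℝ) / 100) : ℝ) ^ 2 ≤ a ^ 2 := by nlinarith [ha.1]
    nlinarith
  have hnode := dWeightNode_fermiEnergyOf_mem_Icc_of_mem_box_num (El := ((429 : ℝ) / 250)) (Eh := ((6317 : ℝ) / 2500)) (lo := ((314 : ℝ) / 625)) (hi := 1)
    (by norm_num) (by norm_num) (by norm_num) (by norm_num) hΔ ha hb hc (by norm_num) (by norm_num) (by norm_num) hF.1 hT.2 (by norm_num [dWeightNodeCF])
    (dWeightNodeCF_le_one (by norm_num) (by norm_num) (by norm_num) (by norm_num))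
  have hlink := (dWeight_mem_Icc_node_axis (le_of_lt (lt_of_lt_of_le (by norm_num) hΔ.1)) (le_trans (by norm_num) hc.1) ((hc.2.trans (by norm_num)).trans hb.1)
    (lt_of_lt_of_le (by norm_num) hb.1) (ne_of_gt (lt_of_lt_of_le (by norm_num) ha.1)) hε0 hmE hx hy hP).2.1
  exact ⟨hnode.1.trans hlink, dWeight_le_of_mem_box_axis' (El := ((429 : ℝ) / 250)) (Eh := ((6317 : ℝ) / 2500)) (by norm_num) (by norm_num) (by norm_num) (by norm_num) (by norm_num) hΔ ha hb hc
    (by norm_num) (by norm_num) (by norm_num) hF.1 hT.2 (by norm_num) (by norm_num) (by norm_num) (by norm_num [dWeightAxisCF]) hx hy hP⟩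

/-- **`emeryBoxYBCO7planeY6K26Src (EmeryBoxesKSlicesE)` (YBa₂Cu₃O₇ plane Cu(2) ((K) #66-type source box)), n_H = 1.16 (ν = 21/50): EVERY Fermi-surface Bloch state of EVERY member has Cu-d weight in `[0.5724, 0.7635]`** — node floor
`dWeightNodeCF(Δ₁, a₁, b₂ − c₁; E_h)` (two-corner rule, §B.89 (c)) and axis ceiling `dWeightAxisCF(Δ₂, a₁, c₂; E_l)` (§B.90 (e)); brackets `scalePt_YBCO7NH116_FL_br` / `scalePt_YBCO7NH116_TP_br`; any Fermi-surface topology. [folklore] -/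
theorem yBCO7Box_dWeightFS_mem_nH116 {Δ a b c x y : ℝ} (hΔ : Δ ∈ Icc ((7 : ℝ) / 4) ((47 : ℝ) / 20)) (ha : a ∈ Icc ((117 : ℝ) / 100) ((139 : ℝ) / 100)) (hb : b ∈ Icc ((61 : ℝ) / 100) ((73 : ℝ) / 100))
    (hc : c ∈ Icc ((3 : ℝ) / 20) ((3 : ℝ) / 20)) (hx : x ∈ Icc (0 : ℝ) 1) (hy : y ∈ Icc (0 : ℝ) 1)
    (hP : charCubic Δ a b c x y (fermiEnergyOf Δ a b c ((21 : ℝ) / 50)) = 0) :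
    dWeight Δ a b c x y (fermiEnergyOf Δ a b c ((21 : ℝ) / 50)) ∈ Icc ((1431 : ℝ) / 2500) ((1527 : ℝ) / 2000) := by
  have hF := (fermiEnergyOf_of_pointBracketCheck scalePt_YBCO7NH116_FL_br (by norm_num) (by norm_num) (by norm_num) (ν := (21/50 : ℝ))
    (by push_cast; exact ⟨le_rfl, le_rfl⟩)).2
  have hT := (fermiEnergyOf_of_pointBracketCheck scalePt_YBCO7NH116_TP_br (by norm_num) (by norm_num) (by norm_num) (ν := (21/50 : ℝ))
    (by push_cast; exact ⟨le_rfl, le_rfl⟩)).2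
  push_cast at hF hT
  have hbox := fermiEnergyOf_mem_Icc_of_mem_box' (Δ₁ := ((7 : ℝ) / 4)) (Δ₂ := ((47 : ℝ) / 20)) (a₁ := ((117 : ℝ) / 100)) (a₂ := ((139 : ℝ) / 100)) (b₁ := ((61 : ℝ) / 100)) (b₂ := ((73 : ℝ) / 100)) (c₁ := ((3 : ℝ) / 20)) (c₂ := ((3 : ℝ) / 20))
    (ν := ((21 : ℝ) / 50)) (by norm_num) (by norm_num) (by norm_num) (by norm_num) hΔ ha hb hc (by norm_num) (by norm_num)
  have hε0 : 0 < fermiEnergyOf Δ a b c ((21 : ℝ) / 50) := lt_of_lt_of_le (by norm_num) (hF.1.trans hbox.1)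
  have hmE : c * fermiEnergyOf Δ a b c ((21 : ℝ) / 50) < a ^ 2 := by
    have h1 : c * fermiEnergyOf Δ a b c ((21 : ℝ) / 50) ≤ ((3 : ℝ) / 20) * ((4893 : ℝ) / 2500) := mul_le_mul hc.2 (hbox.2.trans hT.2) hε0.le (by norm_num)
    have h2 : (((117 : ℝ) / 100) : ℝ) ^ 2 ≤ a ^ 2 := by nlinarith [ha.1]
    nlinarith
  have hnode := dWeightNode_fermiEnergyOf_mem_Icc_of_mem_box_num (El := ((67 : ℝ) / 50)) (Eh := ((4893 : ℝ) / 2500)) (lo := ((1431 : ℝ) / 2500)) (hi := 1)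
    (by norm_num) (by norm_num) (by norm_num) (by norm_num) hΔ ha hb hc (by norm_num) (by norm_num) (by norm_num) hF.1 hT.2 (by norm_num [dWeightNodeCF])
    (dWeightNodeCF_le_one (by norm_num) (by norm_num) (by norm_num) (by norm_num))
  have hlink := (dWeight_mem_Icc_node_axis (le_of_lt (lt_of_lt_of_le (by norm_num) hΔ.1)) (le_trans (by norm_num) hc.1) ((hc.2.trans (by norm_num)).trans hb.1)
    (lt_of_lt_of_le (by norm_num) hb.1) (ne_of_gt (lt_of_lt_of_le (by norm_num) ha.1)) hε0 hmE hx hy hP).2.1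
  exact ⟨hnode.1.trans hlink, dWeight_le_of_mem_box_axis' (El := ((67 : ℝ) / 50)) (Eh := ((4893 : ℝ) / 2500)) (by norm_num) (by norm_num) (by norm_num) (by norm_num) (by norm_num) hΔ ha hb hc
    (by norm_num) (by norm_num) (by norm_num) hF.1 hT.2 (by norm_num) (by norm_num) (by norm_num) (by norm_num [dWeightAxisCF]) hx hy hP⟩

/-- **`emeryBoxCCOCK26Src (EmeryBoxesKSlicesB)` (Ca₂₋ₓNaₓCuO₂Cl₂ x = 0.10 ((K) #3 source box)), n_H = 1.10 (ν = 9/20): EVERY Fermi-surface Bloch state of EVERY member has Cu-d weight in `[0.5966, 0.777]`** — node floor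
`dWeightNodeCF(Δ₁, a₁, b₂ − c₁; E_h)` (two-corner rule, §B.89 (c)) and axis ceiling `dWeightAxisCF(Δ₂, a₁, c₂; E_l)` (§B.90 (e)); brackets `scalePt_CCOCNH110_FL_br` / `scalePt_CCOCNH110_TP_br`; any Fermi-surface topology. [folklore] -/
theorem cCOCBox_dWeightFS_mem_nH110 {Δ a b c x y : ℝ} (hΔ : Δ ∈ Icc ((41 : ℝ) / 20) ((133 : ℝ) / 50)) (ha : a ∈ Icc ((117 : ℝ) / 100) ((139 : ℝ) / 100)) (hb : b ∈ Icc ((29 : ℝ) / 50) ((69 : ℝ) / 100))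
    (hc : c ∈ Icc ((13 : ℝ) / 100) ((17 : ℝ) / 125)) (hx : x ∈ Icc (0 : ℝ) 1) (hy : y ∈ Icc (0 : ℝ) 1)
    (hP : charCubic Δ a b c x y (fermiEnergyOf Δ a b c ((9 : ℝ) / 20)) = 0) :
    dWeight Δ a b c x y (fermiEnergyOf Δ a b c ((9 : ℝ) / 20)) ∈ Icc ((2983 : ℝ) / 5000) ((777 : ℝ) / 1000) := by
  have hF := (fermiEnergyOf_of_pointBracketCheck scalePt_CCOCNH110_FL_br (by norm_num) (by norm_num) (by norm_num) (ν := (9/20 : ℝ))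
    (by push_cast; exact ⟨le_rfl, le_rfl⟩)).2
  have hT := (fermiEnergyOf_of_pointBracketCheck scalePt_CCOCNH110_TP_br (by norm_num) (by norm_num) (by norm_num) (ν := (9/20 : ℝ))
    (by push_cast; exact ⟨le_rfl, le_rfl⟩)).2
  push_cast at hF hT
  have hbox := fermiEnergyOf_mem_Icc_of_mem_box' (Δ₁ := ((41 : ℝ) / 20)) (Δ₂ := ((133 : ℝ) / 50)) (a₁ := ((117 : ℝ) / 100)) (a₂ := ((139 : ℝ) / 100)) (b₁ := ((29 : ℝ) / 50)) (b₂ := ((69 : ℝ) / 100)) (c₁ := ((13 : ℝ) / 100)) (c₂ := ((17 : ℝ) / 125))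
    (ν := ((9 : ℝ) / 20)) (by norm_num) (by norm_num) (by norm_num) (by norm_num) hΔ ha hb hc (by norm_num) (by norm_num)
  have hε0 : 0 < fermiEnergyOf Δ a b c ((9 : ℝ) / 20) := lt_of_lt_of_le (by norm_num) (hF.1.trans hbox.1)
  have hmE : c * fermiEnergyOf Δ a b c ((9 : ℝ) / 20) < a ^ 2 := by
    have h1 : c * fermiEnergyOf Δ a b c ((9 : ℝ) / 20) ≤ ((17 : ℝ) / 125) * ((9643 : ℝ) / 5000) := mul_le_mul hc.2 (hbox.2.trans hT.2) hε0.le (by norm_num)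
    have h2 : (((117 : ℝ) / 100) : ℝ) ^ 2 ≤ a ^ 2 := by nlinarith [ha.1]
    nlinarith
  have hnode := dWeightNode_fermiEnergyOf_mem_Icc_of_mem_box_num (El := ((13103 : ℝ) / 10000)) (Eh := ((9643 : ℝ) / 5000)) (lo := ((2983 : ℝ) / 5000)) (hi := 1)
    (by norm_num) (by norm_num) (by norm_num) (by norm_num) hΔ ha hb hc (by norm_num) (by norm_num) (by norm_num) hF.1 hT.2 (by norm_num [dWeightNodeCF])
    (dWeightNodeCF_le_one (by norm_num) (by norm_num) (by norm_num) (by norm_num))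
  have hlink := (dWeight_mem_Icc_node_axis (le_of_lt (lt_of_lt_of_le (by norm_num) hΔ.1)) (le_trans (by norm_num) hc.1) ((hc.2.trans (by norm_num)).trans hb.1)
    (lt_of_lt_of_le (by norm_num) hb.1) (ne_of_gt (lt_of_lt_of_le (by norm_num) ha.1)) hε0 hmE hx hy hP).2.1
  exact ⟨hnode.1.trans hlink, dWeight_le_of_mem_box_axis' (El := ((13103 : ℝ) / 10000)) (Eh := ((9643 : ℝ) / 5000)) (by norm_num) (by norm_num) (by norm_num) (by norm_num) (by norm_num) hΔ ha hb hc
    (by norm_num) (by norm_num) (by norm_num) hF.1 hT.2 (by norm_num) (by norm_num) (by norm_num) (by norm_num [dWeightAxisCF]) hx hy hP⟩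

/-- **`emeryBoxBi2201M61MoreePPSrc (EmeryBoxesKSlicesN)` (Bi₂Sr₂CuO₆₊δ (M61; Morée PP source box)), n_H = 1.144 (ν = 107/250): EVERY Fermi-surface Bloch state of EVERY member has Cu-d weight in `[0.5644, 0.7561]`** — node floor
`dWeightNodeCF(Δ₁, a₁, b₂ − c₁; E_h)` (two-corner rule, §B.89 (c)) and axis ceiling `dWeightAxisCF(Δ₂, a₁, c₂; E_l)` (§B.90 (e)); brackets `scalePt_Bi2201NH1144_FL_br` / `scalePt_Bi2201NH1144_TP_br`; any Fermi-surface topology. [folklore] -/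
theorem bi2201Box_dWeightFS_mem_nH1144 {Δ a b c x y : ℝ} (hΔ : Δ ∈ Icc ((44 : ℝ) / 25) ((59 : ℝ) / 25)) (ha : a ∈ Icc ((5 : ℝ) / 4) ((147 : ℝ) / 100)) (hb : b ∈ Icc ((31 : ℝ) / 50) ((37 : ℝ) / 50))
    (hc : c ∈ Icc ((7 : ℝ) / 50) ((17 : ℝ) / 100)) (hx : x ∈ Icc (0 : ℝ) 1) (hy : y ∈ Icc (0 : ℝ) 1)
    (hP : charCubic Δ a b c x y (fermiEnergyOf Δ a b c ((107 : ℝ) / 250)) = 0) :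
    dWeight Δ a b c x y (fermiEnergyOf Δ a b c ((107 : ℝ) / 250)) ∈ Icc ((1411 : ℝ) / 2500) ((7561 : ℝ) / 10000) := by
  have hF := (fermiEnergyOf_of_pointBracketCheck scalePt_Bi2201NH1144_FL_br (by norm_num) (by norm_num) (by norm_num) (ν := (107/250 : ℝ))
    (by push_cast; exact ⟨le_rfl, le_rfl⟩)).2
  have hT := (fermiEnergyOf_of_pointBracketCheck scalePt_Bi2201NH1144_TP_br (by norm_num) (by norm_num) (by norm_num) (ν := (107/250 : ℝ))
    (by push_cast; exact ⟨le_rfl, le_rfl⟩)).2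
  push_cast at hF hT
  have hbox := fermiEnergyOf_mem_Icc_of_mem_box' (Δ₁ := ((44 : ℝ) / 25)) (Δ₂ := ((59 : ℝ) / 25)) (a₁ := ((5 : ℝ) / 4)) (a₂ := ((147 : ℝ) / 100)) (b₁ := ((31 : ℝ) / 50)) (b₂ := ((37 : ℝ) / 50)) (c₁ := ((7 : ℝ) / 50)) (c₂ := ((17 : ℝ) / 100))
    (ν := ((107 : ℝ) / 250)) (by norm_num) (by norm_num) (by norm_num) (by norm_num) hΔ ha hb hc (by norm_num) (by norm_num)
  have hε0 : 0 < fermiEnergyOf Δ a b c ((107 : ℝ) / 250) := lt_of_lt_of_le (by norm_num) (hF.1.trans hbox.1)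
  have hmE : c * fermiEnergyOf Δ a b c ((107 : ℝ) / 250) < a ^ 2 := by
    have h1 : c * fermiEnergyOf Δ a b c ((107 : ℝ) / 250) ≤ ((17 : ℝ) / 100) * ((2131 : ℝ) / 1000) := mul_le_mul hc.2 (hbox.2.trans hT.2) hε0.le (by norm_num)
    have h2 : (((5 : ℝ) / 4) : ℝ) ^ 2 ≤ a ^ 2 := by nlinarith [ha.1]
    nlinarith
  have hnode := dWeightNode_fermiEnergyOf_mem_Icc_of_mem_box_num (El := ((1841 : ℝ) / 1250)) (Eh := ((2131 : ℝ) / 1000)) (lo := ((1411 : ℝ) / 2500)) (hi := 1)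
    (by norm_num) (by norm_num) (by norm_num) (by norm_num) hΔ ha hb hc (by norm_num) (by norm_num) (by norm_num) hF.1 hT.2 (by norm_num [dWeightNodeCF])
    (dWeightNodeCF_le_one (by norm_num) (by norm_num) (by norm_num) (by norm_num))
  have hlink := (dWeight_mem_Icc_node_axis (le_of_lt (lt_of_lt_of_le (by norm_num) hΔ.1)) (le_trans (by norm_num) hc.1) ((hc.2.trans (by norm_num)).trans hb.1)
    (lt_of_lt_of_le (by norm_num) hb.1) (ne_of_gt (lt_of_lt_of_le (by norm_num) ha.1)) hε0 hmE hx hy hP).2.1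
  exact ⟨hnode.1.trans hlink, dWeight_le_of_mem_box_axis' (El := ((1841 : ℝ) / 1250)) (Eh := ((2131 : ℝ) / 1000)) (by norm_num) (by norm_num) (by norm_num) (by norm_num) (by norm_num) hΔ ha hb hc
    (by norm_num) (by norm_num) (by norm_num) hF.1 hT.2 (by norm_num) (by norm_num) (by norm_num) (by norm_num [dWeightAxisCF]) hx hy hP⟩

/-- **`emeryBoxBi2201M61MoreePPSrc (EmeryBoxesKSlicesN)` (Bi₂Sr₂CuO₆₊δ (M61; Morée PP source box)), n_H = 1.176 (ν = 103/250): EVERY Fermi-surface Bloch state of EVERY member has Cu-d weight in `[0.5677, 0.7576]`** — node floor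
`dWeightNodeCF(Δ₁, a₁, b₂ − c₁; E_h)` (two-corner rule, §B.89 (c)) and axis ceiling `dWeightAxisCF(Δ₂, a₁, c₂; E_l)` (§B.90 (e)); brackets `scalePt_Bi2201NH1176_FL_br` / `scalePt_Bi2201NH1176_TP_br`; any Fermi-surface topology. [folklore] -/
theorem bi2201Box_dWeightFS_mem_nH1176 {Δ a b c x y : ℝ} (hΔ : Δ ∈ Icc ((44 : ℝ) / 25) ((59 : ℝ) / 25)) (ha : a ∈ Icc ((5 : ℝ) / 4) ((147 : ℝ) / 100)) (hb : b ∈ Icc ((31 : ℝ) / 50) ((37 : ℝ) / 50))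
    (hc : c ∈ Icc ((7 : ℝ) / 50) ((17 : ℝ) / 100)) (hx : x ∈ Icc (0 : ℝ) 1) (hy : y ∈ Icc (0 : ℝ) 1)
    (hP : charCubic Δ a b c x y (fermiEnergyOf Δ a b c ((103 : ℝ) / 250)) = 0) :
    dWeight Δ a b c x y (fermiEnergyOf Δ a b c ((103 : ℝ) / 250)) ∈ Icc ((5677 : ℝ) / 10000) ((947 : ℝ) / 1250) := by
  have hF := (fermiEnergyOf_of_pointBracketCheck scalePt_Bi2201NH1176_FL_br (by norm_num) (by norm_num) (by norm_num) (ν := (103/250 : ℝ))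
    (by push_cast; exact ⟨le_rfl, le_rfl⟩)).2
  have hT := (fermiEnergyOf_of_pointBracketCheck scalePt_Bi2201NH1176_TP_br (by norm_num) (by norm_num) (by norm_num) (ν := (103/250 : ℝ))
    (by push_cast; exact ⟨le_rfl, le_rfl⟩)).2
  push_cast at hF hT
  have hbox := fermiEnergyOf_mem_Icc_of_mem_box' (Δ₁ := ((44 : ℝ) / 25)) (Δ₂ := ((59 : ℝ) / 25)) (a₁ := ((5 : ℝ) / 4)) (a₂ := ((147 : ℝ) / 100)) (b₁ := ((31 : ℝ) / 50)) (b₂ := ((37 : ℝ) / 50)) (c₁ := ((7 : ℝ) / 50)) (c₂ := ((17 : ℝ) / 100))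
    (ν := ((103 : ℝ) / 250)) (by norm_num) (by norm_num) (by norm_num) (by norm_num) hΔ ha hb hc (by norm_num) (by norm_num)
  have hε0 : 0 < fermiEnergyOf Δ a b c ((103 : ℝ) / 250) := lt_of_lt_of_le (by norm_num) (hF.1.trans hbox.1)
  have hmE : c * fermiEnergyOf Δ a b c ((103 : ℝ) / 250) < a ^ 2 := by
    have h1 : c * fermiEnergyOf Δ a b c ((103 : ℝ) / 250) ≤ ((17 : ℝ) / 100) * ((20919 : ℝ) / 10000) := mul_le_mul hc.2 (hbox.2.trans hT.2) hε0.le (by norm_num)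
    have h2 : (((5 : ℝ) / 4) : ℝ) ^ 2 ≤ a ^ 2 := by nlinarith [ha.1]
    nlinarith
  have hnode := dWeightNode_fermiEnergyOf_mem_Icc_of_mem_box_num (El := ((1807 : ℝ) / 1250)) (Eh := ((20919 : ℝ) / 10000)) (lo := ((5677 : ℝ) / 10000)) (hi := 1)
    (by norm_num) (by norm_num) (by norm_num) (by norm_num) hΔ ha hb hc (by norm_num) (by norm_num) (by norm_num) hF.1 hT.2 (by norm_num [dWeightNodeCF])
    (dWeightNodeCF_le_one (by norm_num) (by norm_num) (by norm_num) (by norm_num))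
  have hlink := (dWeight_mem_Icc_node_axis (le_of_lt (lt_of_lt_of_le (by norm_num) hΔ.1)) (le_trans (by norm_num) hc.1) ((hc.2.trans (by norm_num)).trans hb.1)
    (lt_of_lt_of_le (by norm_num) hb.1) (ne_of_gt (lt_of_lt_of_le (by norm_num) ha.1)) hε0 hmE hx hy hP).2.1
  exact ⟨hnode.1.trans hlink, dWeight_le_of_mem_box_axis' (El := ((1807 : ℝ) / 1250)) (Eh := ((20919 : ℝ) / 10000)) (by norm_num) (by norm_num) (by norm_num) (by norm_num) (by norm_num) hΔ ha hb hc
    (by norm_num) (by norm_num) (by norm_num) hF.1 hT.2 (by norm_num) (by norm_num) (by norm_num) (by norm_num [dWeightAxisCF]) hx hy hP⟩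

/-- **`emeryBoxTl2201K26Src (EmeryBoxesKSlicesB)` (Tl₂Ba₂CuO₆ ((K) #12 source POINT)), n_H = 1.25 (ν = 3/8): EVERY Fermi-surface Bloch state of EVERY member has Cu-d weight in `[0.6289, 0.7129]`** — node floor
`dWeightNodeCF(Δ₁, a₁, b₂ − c₁; E_h)` (two-corner rule, §B.89 (c)) and axis ceiling `dWeightAxisCF(Δ₂, a₁, c₂; E_l)` (§B.90 (e)); brackets `scalePt_Tl2201NH125_FL_br` / `scalePt_Tl2201NH125_TP_br`; any Fermi-surface topology. [folklore] -/
theorem tl2201Box_dWeightFS_mem_nH125 {Δ a b c x y : ℝ} (hΔ : Δ ∈ Icc ((179 : ℝ) / 100) ((179 : ℝ) / 100)) (ha : a ∈ Icc ((127 : ℝ) / 100) ((127 : ℝ) / 100)) (hb : b ∈ Icc ((63 : ℝ) / 100) ((63 : ℝ) / 100))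
    (hc : c ∈ Icc ((3 : ℝ) / 20) ((3 : ℝ) / 20)) (hx : x ∈ Icc (0 : ℝ) 1) (hy : y ∈ Icc (0 : ℝ) 1)
    (hP : charCubic Δ a b c x y (fermiEnergyOf Δ a b c ((3 : ℝ) / 8)) = 0) :
    dWeight Δ a b c x y (fermiEnergyOf Δ a b c ((3 : ℝ) / 8)) ∈ Icc ((6289 : ℝ) / 10000) ((7129 : ℝ) / 10000) := by
  have hF := (fermiEnergyOf_of_pointBracketCheck scalePt_Tl2201NH125_FL_br (by norm_num) (by norm_num) (by norm_num) (ν := (3/8 : ℝ))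
    (by push_cast; exact ⟨le_rfl, le_rfl⟩)).2
  have hT := (fermiEnergyOf_of_pointBracketCheck scalePt_Tl2201NH125_TP_br (by norm_num) (by norm_num) (by norm_num) (ν := (3/8 : ℝ))
    (by push_cast; exact ⟨le_rfl, le_rfl⟩)).2
  push_cast at hF hT
  have hbox := fermiEnergyOf_mem_Icc_of_mem_box' (Δ₁ := ((179 : ℝ) / 100)) (Δ₂ := ((179 : ℝ) / 100)) (a₁ := ((127 : ℝ) / 100)) (a₂ := ((127 : ℝ) / 100)) (b₁ := ((63 : ℝ) / 100)) (b₂ := ((63 : ℝ) / 100)) (c₁ := ((3 : ℝ) / 20)) (c₂ := ((3 : ℝ) / 20))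
    (ν := ((3 : ℝ) / 8)) (by norm_num) (by norm_num) (by norm_num) (by norm_num) hΔ ha hb hc (by norm_num) (by norm_num)
  have hε0 : 0 < fermiEnergyOf Δ a b c ((3 : ℝ) / 8) := lt_of_lt_of_le (by norm_num) (hF.1.trans hbox.1)
  have hmE : c * fermiEnergyOf Δ a b c ((3 : ℝ) / 8) < a ^ 2 := by
    have h1 : c * fermiEnergyOf Δ a b c ((3 : ℝ) / 8) ≤ ((3 : ℝ) / 20) * ((8107 : ℝ) / 5000) := mul_le_mul hc.2 (hbox.2.trans hT.2) hε0.le (by norm_num)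
    have h2 : (((127 : ℝ) / 100) : ℝ) ^ 2 ≤ a ^ 2 := by nlinarith [ha.1]
    nlinarith
  have hnode := dWeightNode_fermiEnergyOf_mem_Icc_of_mem_box_num (El := ((8057 : ℝ) / 5000)) (Eh := ((8107 : ℝ) / 5000)) (lo := ((6289 : ℝ) / 10000)) (hi := 1)
    (by norm_num) (by norm_num) (by norm_num) (by norm_num) hΔ ha hb hc (by norm_num) (by norm_num) (by norm_num) hF.1 hT.2 (by norm_num [dWeightNodeCF])
    (dWeightNodeCF_le_one (by norm_num) (by norm_num) (by norm_num) (by norm_num))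
  have hlink := (dWeight_mem_Icc_node_axis (le_of_lt (lt_of_lt_of_le (by norm_num) hΔ.1)) (le_trans (by norm_num) hc.1) ((hc.2.trans (by norm_num)).trans hb.1)
    (lt_of_lt_of_le (by norm_num) hb.1) (ne_of_gt (lt_of_lt_of_le (by norm_num) ha.1)) hε0 hmE hx hy hP).2.1
  exact ⟨hnode.1.trans hlink, dWeight_le_of_mem_box_axis' (El := ((8057 : ℝ) / 5000)) (Eh := ((8107 : ℝ) / 5000)) (by norm_num) (by norm_num) (by norm_num) (by norm_num) (by norm_num) hΔ ha hb hc
    (by norm_num) (by norm_num) (by norm_num) hF.1 hT.2 (by norm_num) (by norm_num) (by norm_num) (by norm_num [dWeightAxisCF]) hx hy hP⟩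

/-- **`emeryBoxTl2201K26Src (EmeryBoxesKSlicesB)` (Tl₂Ba₂CuO₆ ((K) #12 source POINT)), n_H = 1.30 (ν = 7/20): EVERY Fermi-surface Bloch state of EVERY member has Cu-d weight in `[0.6325, 0.7145]`** — node floor
`dWeightNodeCF(Δ₁, a₁, b₂ − c₁; E_h)` (two-corner rule, §B.89 (c)) and axis ceiling `dWeightAxisCF(Δ₂, a₁, c₂; E_l)` (§B.90 (e)); brackets `scalePt_Tl2201NH130_FL_br` / `scalePt_Tl2201NH130_TP_br`; any Fermi-surface topology. [folklore] -/
theorem tl2201Box_dWeightFS_mem_nH130 {Δ a b c x y : ℝ} (hΔ : Δ ∈ Icc ((179 : ℝ) / 100) ((179 : ℝ) / 100)) (ha : a ∈ Icc ((127 : ℝ) / 100) ((127 : ℝ) / 100)) (hb : b ∈ Icc ((63 : ℝ) / 100) ((63 : ℝ) / 100))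
    (hc : c ∈ Icc ((3 : ℝ) / 20) ((3 : ℝ) / 20)) (hx : x ∈ Icc (0 : ℝ) 1) (hy : y ∈ Icc (0 : ℝ) 1)
    (hP : charCubic Δ a b c x y (fermiEnergyOf Δ a b c ((7 : ℝ) / 20)) = 0) :
    dWeight Δ a b c x y (fermiEnergyOf Δ a b c ((7 : ℝ) / 20)) ∈ Icc ((253 : ℝ) / 400) ((1429 : ℝ) / 2000) := by
  have hF := (fermiEnergyOf_of_pointBracketCheck scalePt_Tl2201NH130_FL_br (by norm_num) (by norm_num) (by norm_num) (ν := (7/20 : ℝ))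
    (by push_cast; exact ⟨le_rfl, le_rfl⟩)).2
  have hT := (fermiEnergyOf_of_pointBracketCheck scalePt_Tl2201NH130_TP_br (by norm_num) (by norm_num) (by norm_num) (ν := (7/20 : ℝ))
    (by push_cast; exact ⟨le_rfl, le_rfl⟩)).2
  push_cast at hF hT
  have hbox := fermiEnergyOf_mem_Icc_of_mem_box' (Δ₁ := ((179 : ℝ) / 100)) (Δ₂ := ((179 : ℝ) / 100)) (a₁ := ((127 : ℝ) / 100)) (a₂ := ((127 : ℝ) / 100)) (b₁ := ((63 : ℝ) / 100)) (b₂ := ((63 : ℝ) / 100)) (c₁ := ((3 : ℝ) / 20)) (c₂ := ((3 : ℝ) / 20))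
    (ν := ((7 : ℝ) / 20)) (by norm_num) (by norm_num) (by norm_num) (by norm_num) hΔ ha hb hc (by norm_num) (by norm_num)
  have hε0 : 0 < fermiEnergyOf Δ a b c ((7 : ℝ) / 20) := lt_of_lt_of_le (by norm_num) (hF.1.trans hbox.1)
  have hmE : c * fermiEnergyOf Δ a b c ((7 : ℝ) / 20) < a ^ 2 := by
    have h1 : c * fermiEnergyOf Δ a b c ((7 : ℝ) / 20) ≤ ((3 : ℝ) / 20) * ((15873 : ℝ) / 10000) := mul_le_mul hc.2 (hbox.2.trans hT.2) hε0.le (by norm_num)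
    have h2 : (((127 : ℝ) / 100) : ℝ) ^ 2 ≤ a ^ 2 := by nlinarith [ha.1]
    nlinarith
  have hnode := dWeightNode_fermiEnergyOf_mem_Icc_of_mem_box_num (El := ((15773 : ℝ) / 10000)) (Eh := ((15873 : ℝ) / 10000)) (lo := ((253 : ℝ) / 400)) (hi := 1)
    (by norm_num) (by norm_num) (by norm_num) (by norm_num) hΔ ha hb hc (by norm_num) (by norm_num) (by norm_num) hF.1 hT.2 (by norm_num [dWeightNodeCF])
    (dWeightNodeCF_le_one (by norm_num) (by norm_num) (by norm_num) (by norm_num))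
  have hlink := (dWeight_mem_Icc_node_axis (le_of_lt (lt_of_lt_of_le (by norm_num) hΔ.1)) (le_trans (by norm_num) hc.1) ((hc.2.trans (by norm_num)).trans hb.1)
    (lt_of_lt_of_le (by norm_num) hb.1) (ne_of_gt (lt_of_lt_of_le (by norm_num) ha.1)) hε0 hmE hx hy hP).2.1
  exact ⟨hnode.1.trans hlink, dWeight_le_of_mem_box_axis' (El := ((15773 : ℝ) / 10000)) (Eh := ((15873 : ℝ) / 10000)) (by norm_num) (by norm_num) (by norm_num) (by norm_num) (by norm_num) hΔ ha hb hc
    (by norm_num) (by norm_num) (by norm_num) hF.1 hT.2 (by norm_num) (by norm_num) (by norm_num) (by norm_num [dWeightAxisCF]) hx hy hP⟩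

end Summit.Ventures.CertifiedManyBodySolver.Downfold.Emery
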